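import Literature.NumberTheory.EllipticCurves.TwoDescentLocalPadic
import Literature.NumberTheory.EllipticCurves.TwoDescentCharSum
import Literature.Barriers.BirchSwinnertonDyer.RankNotSumOfLocalInvariantsTwistDyadic
import HarnessLib

/-!
# `rk E(F₄)` for `E = 480a1`: the dyadic local conditions on `E` over `ℚ₂`

For the `2`-descents of `E = 480a1 : y² = x(x + 2)(x - 3)` over the real quadratic fields
`ℚ(√41)`, `ℚ(√73)` (minimal subfields of `F₄ = ℚ(√-1, √41, √73)`; T. Dokchitser–V. Dokchitser,
*A note on the Mordell–Weil rank modulo n*, J. Number Theory 131 (2011), proof of Thm. 2: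
"2-descent shows that `rk E/F₄ = 6` … over all minimal non-trivial subfields") the prime `2`
splits (`41 ≡ 73 ≡ 1 mod 8`), so the dyadic completions are `ℚ₂` and the dyadic local conditions
are those of `E` over `ℚ₂`. This file proves them for ARBITRARY `ℚ₂`-points (not only rational
ones, as the tree's `TwistDyadic` file does for the twists `E^{(d)}`, `d ≡ 7 mod 8`):

* `dyadic_conditions_480a1` — for `x, y ∈ ℚ₂`, `y ≠ 0`, `y² = x(x + 2)(x - 3)`:
  `v₂(x) ≡ v₂(x + 2) (mod 2)`, `pc4 (x + 2) = 0` (the odd part of `x + 2` is `1 mod 4`) and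
  `pc8 (x + 2) = pc8 x + (v₂(x) mod 2)`,

three independent linear conditions on the image of `(x, x + 2)` in `ℚ₂*/ℚ₂*² × ℚ₂*/ℚ₂*²`, hence
exactly the local image (of order `8 = 2 · #E(ℚ₂)[2]`; Silverman, *AEC*, X.1, Prop. X.1.4 /
Example X.1.5), by the case analysis on `v₂(x)` with residues of odd parts modulo `8`
(`TwoDescentLocalPadic.lean`: `pres8`, `pres8_add_of_eq`).

Theorems only; no definitions, no named facts.

## References

* T. Dokchitser, V. Dokchitser, *A note on the Mordell–Weil rank modulo n*, J. Number Theory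
  131 (2011) 1833–1839, arXiv:0910.4588, proof of Thm. 2. [DokchitserDokchitser2011RankModN]
* J. H. Silverman, *The Arithmetic of Elliptic Curves*, 2nd ed., GTM 106 (2009), Prop. X.1.4,
  Example X.1.5. [SilvermanAEC2009]
-/

noncomputable section

open scoped Classical

namespace Literature.Barriers.BirchSwinnertonDyer

namespace DokchitserDokchitser2011

open Literature.NumberTheory.EllipticCurves.KramerTwoDescent
open Literature.NumberTheory.EllipticCurves.TwoDescentLocal

/-! ### `2`-adic constants -/

/-- `v₂(2) = 1` in `ℚ₂`. [folklore] -/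
theorem valuation_two : (2 : ℚ_[2]).valuation = 1 := by
  have h := @Padic.valuation_p 2 _
  rwa [Nat.cast_ofNat] at h

/-- The odd part of `2` is `1 mod 8`. [folklore] -/
theorem pres8_two : pres8 (2 : ℚ_[2]) = 1 := by
  rw [show (2 : ℚ_[2]) = ((2 : ℚ) : ℚ_[2]) by norm_num, pres8_ratCast]
  exact res8_values.2.1

/-- `v₂(3) = 0`. [folklore] -/
theorem valuation_three : (3 : ℚ_[2]).valuation = 0 := by
  rw [show (3 : ℚ_[2]) = ((3 : ℚ) : ℚ_[2]) by norm_num, Padic.valuation_ratCast,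
    show (3 : ℚ) = ((3 : ℤ) : ℚ) by norm_num, padicValRat_intCast_eq_zero (by decide)]

/-- `pres8 3 = 3`. [folklore] -/
theorem pres8_three : pres8 (3 : ℚ_[2]) = 3 := by
  rw [show (3 : ℚ_[2]) = ((3 : ℚ) : ℚ_[2]) by norm_num, pres8_ratCast]
  exact res8_values.2.2.1

/-- `v₂(-3) = 0`. [folklore] -/
theorem valuation_neg_three : (-3 : ℚ_[2]).valuation = 0 := by
  rw [show (-3 : ℚ_[2]) = ((-3 : ℚ) : ℚ_[2]) by norm_num, Padic.valuation_ratCast,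
    show (-3 : ℚ) = ((-3 : ℤ) : ℚ) by norm_num, padicValRat_intCast_eq_zero (by decide)]

/-- `pres8 (-3) = 5`. [folklore] -/
theorem pres8_neg_three : pres8 (-3 : ℚ_[2]) = 5 := by
  rw [show (-3 : ℚ_[2]) = ((-3 : ℚ) : ℚ_[2]) by norm_num, pres8_ratCast,
    show (-3 : ℚ) = ((-3 : ℤ) : ℚ) by norm_num, res8_intCast (by decide)]
  decide

/-- `pres8 (-t) = 7 · pres8 t`. [folklore] -/
theorem pres8_neg {t : ℚ_[2]} (ht : t ≠ 0) : pres8 (-t) = 7 * pres8 t := by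
  rw [← neg_one_mul, pres8_mul (neg_ne_zero.mpr one_ne_zero) ht,
    show (-1 : ℚ_[2]) = ((-1 : ℚ) : ℚ_[2]) by norm_num, pres8_ratCast, res8_values.1]

/-- `v₂(-t) = v₂(t)`. [folklore] -/
theorem valuation_neg_two (t : ℚ_[2]) : (-t).valuation = t.valuation := valuation_neg' 2 t

/-! ### The dyadic conditions -/

/-- **The dyadic local conditions on `E = 480a1 : y² = x(x + 2)(x - 3)` over `ℚ₂`.** For all
`x, y ∈ ℚ₂` with `y ≠ 0` on the curve: `v₂(x) ≡ v₂(x + 2) (mod 2)`, `pc4 (x + 2) = 0`, and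
`pc8 (x + 2) = pc8 x + (v₂(x) mod 2)` (Silverman AEC X.1: the image of `E(ℚ₂)/2E(ℚ₂)`, of order
`8`, in `ℚ₂*/ℚ₂*² × ℚ₂*/ℚ₂*²` under `(x, x + 2)`; these three linear conditions define it), by
the case analysis on `v₂(x) < 0`, `= 0`, `= 1`, `≥ 2` with odd parts modulo `8`.
[cite: SilvermanAEC2009, Prop. X.1.4] -/
theorem dyadic_conditions_480a1 {x y : ℚ_[2]} (hy : y ≠ 0)
    (h : y ^ 2 = x * (x + 2) * (x - 3)) :
    (padicPlace 2).parity x = (padicPlace 2).parity (x + 2) ∧ pc4 (x + 2) = 0 ∧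
      pc8 (x + 2) = pc8 x + (padicPlace 2).parity x := by
  -- non-vanishing of the three factors
  have h₀ : x * (x + 2) * (x - 3) ≠ 0 := h ▸ pow_ne_zero 2 hy
  have hx : x ≠ 0 := fun h0 => h₀ (by rw [h0, zero_mul, zero_mul])
  have hx₂ : x + 2 ≠ 0 := fun h0 => h₀ (by rw [h0, mul_zero, zero_mul])
  have hx₃ : x - 3 ≠ 0 := fun h0 => h₀ (by rw [h0, mul_zero])
  have h2 : (2 : ℚ_[2]) ≠ 0 := two_ne_zero
  have hm3 : (-3 : ℚ_[2]) ≠ 0 := by norm_num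
  have h3 : (3 : ℚ_[2]) ≠ 0 := by norm_num
  -- parity of valuations and the square relation of the residues
  have hsum : Even (x.valuation + (x + 2).valuation + (x - 3).valuation) := by
    have key := congrArg Padic.valuation h
    rw [Padic.valuation_pow, Padic.valuation_mul (mul_ne_zero hx hx₂) hx₃,
      Padic.valuation_mul hx hx₂] at key
    exact ⟨y.valuation, by push_cast at key; omega⟩
  have hsq : pres8 x * pres8 (x + 2) * pres8 (x - 3) = 1 := by
    have key := congrArg pres8 h
    rw [sq, pres8_mul hy hy, pres8_mul_self hy, pres8_mul (mul_ne_zero hx hx₂) hx₃,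
      pres8_mul hx hx₂] at key
    exact key.symm
  have hrx : pres8 x * pres8 x = 1 := pres8_mul_self hx
  have hrx₂ : pres8 (x + 2) * pres8 (x + 2) = 1 := pres8_mul_self hx₂
  have hrx₃ : pres8 (x - 3) * pres8 (x - 3) = 1 := pres8_mul_self hx₃
  -- parity bits
  have par0 : ∀ t : ℚ_[2], Even t.valuation → (padicPlace 2).parity t = 0 := fun t ht =>
    ((padicPlace 2).parity_eq_zero_iff t).mpr ht
  have par1 : ∀ t : ℚ_[2], ¬ Even t.valuation → (padicPlace 2).parity t = 1 := fun t ht =>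
    (padicPlace 2).parity_eq_one_of_not_even ht
  -- rearrangements
  have e₃ : x - 3 = x + (-3) := by ring
  have e₃' : x - 3 = (-3) + x := by ring
  have e₂' : x + 2 = 2 + x := by ring
  set v := x.valuation with hvdef
  rcases lt_trichotomy v 0 with hneg | hzero | hpos
  · ----------------------------------------------------------------
    -- Case `v < 0`: `v₂(x + 2) = v₂(x - 3) = v`, `v` even
    have d₂ := valuation_add_eq_left_of_lt 2 hx h2 (by rw [valuation_two, ← hvdef]; omega)
    have d₃ := valuation_add_eq_left_of_lt 2 hx hm3 (by rw [valuation_neg_three, ← hvdef]; omega)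
    rw [← e₃] at d₃
    rw [← hvdef] at d₂ d₃
    have heven : Even v := by
      rw [d₂.2, d₃.2] at hsum
      obtain ⟨k, hk⟩ := hsum
      exact ⟨k - v, by omega⟩
    have hle : v ≤ -2 := by obtain ⟨k, hk⟩ := heven; omega
    -- residues: `pres8 (x + 2) = pres8 x`
    have r₂ : pres8 (x + 2) = pres8 x := by
      rw [pres8_add_of_eq hx (k := (1 - v).toNat) (by omega) (by rw [valuation_two, ← hvdef]; omega),
        two_pow_eq_zero_of_le (by omega), zero_mul, add_zero]
    have hpar₁ : (padicPlace 2).parity x = 0 := par0 x (by rw [← hvdef]; exact heven)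
    have hpar₂ : (padicPlace 2).parity (x + 2) = 0 := par0 _ (by rw [d₂.2]; exact heven)
    refine ⟨by rw [hpar₁, hpar₂], ?_, by rw [pc8, pc8, r₂, hpar₁, add_zero]⟩
    -- `pc4 (x + 2) = 0`: the residue of `x` is `5` or `1`
    rw [pc4, r₂]
    rcases (show v = -2 ∨ v ≤ -4 by obtain ⟨k, hk⟩ := heven; omega) with hv2 | hv4
    · have r₃ : pres8 (x - 3) = pres8 x + 2 ^ 2 * 5 := by
        rw [e₃, pres8_add_of_eq hx (k := 2) (by omega)
          (by rw [valuation_neg_three, ← hvdef, hv2]; norm_num), pres8_neg_three]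
      rw [r₂, r₃] at hsq
      have key : ∀ r : ZMod (2 ^ 3), r * r = 1 → r * r * (r + 2 ^ 2 * 5) = 1 → chi4Of r = 0 := by
        decide
      exact key _ hrx hsq
    · have r₃ : pres8 (x - 3) = pres8 x := by
        rw [e₃, pres8_add_of_eq hx (k := (-v).toNat) (by omega)
          (by rw [valuation_neg_three, ← hvdef]; omega),
          two_pow_eq_zero_of_le (by omega), zero_mul, add_zero]
      rw [r₂, r₃] at hsq
      have key : ∀ r : ZMod (2 ^ 3), r * r = 1 → r * r * r = 1 → chi4Of r = 0 := by decide
      exact key _ hrx hsq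
  · ----------------------------------------------------------------
    -- Case `v = 0`: `v₂(x + 2) = 0`, `pres8 (x + 2) = pres8 x + 2`; `v₂(x - 3) ≥ 2` even
    have hv₂ : (x + 2).valuation = 0 := by
      have d₂ := valuation_add_eq_left_of_lt 2 hx h2 (by rw [valuation_two, ← hvdef]; omega)
      rw [d₂.2, ← hvdef, hzero]
    have r₂ : pres8 (x + 2) = pres8 x + 2 ^ 1 * 1 := by
      rw [pres8_add_of_eq hx (k := 1) le_rfl (by rw [valuation_two, ← hvdef, hzero]; norm_num),
        pres8_two]
    have hw1 : 1 ≤ (x - 3).valuation := by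
      rw [e₃]
      exact one_le_valuation_add_of_units hx hm3 (by rw [← hvdef, hzero]) valuation_neg_three
        (e₃ ▸ hx₃)
    have hweven : Even (x - 3).valuation := by
      rw [hzero, hv₂, zero_add, zero_add] at hsum; exact hsum
    have hw2 : 2 ≤ (x - 3).valuation := by obtain ⟨k, hk⟩ := hweven; omega
    -- `x = 3 + (x - 3)`: `pres8 x = 3 + 2^w pres8 (x - 3)`
    have rx : pres8 x = 3 + (2 : ZMod (2 ^ 3)) ^ ((x - 3).valuation).toNat * pres8 (x - 3) := by
      have := pres8_add_of_eq (t := (3 : ℚ_[2])) (s := x - 3) h3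
        (k := ((x - 3).valuation).toNat) (by omega) (by rw [valuation_three]; omega)
      rw [show (3 : ℚ_[2]) + (x - 3) = x by ring, pres8_three] at this
      exact this
    have hpar₁ : (padicPlace 2).parity x = 0 := par0 x (by rw [← hvdef, hzero]; exact ⟨0, rfl⟩)
    have hpar₂ : (padicPlace 2).parity (x + 2) = 0 := par0 _ (by rw [hv₂]; exact ⟨0, rfl⟩)
    rcases (show (x - 3).valuation = 2 ∨ 3 ≤ (x - 3).valuation by omega) with hw | hw
    · rw [hw, show ((2 : ℤ)).toNat = 2 from rfl] at rx
      have key : ∀ r r₃ : ZMod (2 ^ 3), r₃ * r₃ = 1 → r = 3 + 2 ^ 2 * r₃ →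
          chi4Of (r + 2 ^ 1 * 1) = 0 ∧ chi8Of (r + 2 ^ 1 * 1) = chi8Of r + 0 := by decide
      obtain ⟨k1, k2⟩ := key _ _ hrx₃ rx
      exact ⟨by rw [hpar₁, hpar₂], by rw [pc4, r₂]; exact k1,
        by rw [pc8, pc8, r₂, hpar₁]; exact k2⟩
    · rw [two_pow_eq_zero_of_le (by omega), zero_mul, add_zero] at rx
      refine ⟨by rw [hpar₁, hpar₂], by rw [pc4, r₂, rx]; decide, ?_⟩
      rw [pc8, pc8, r₂, rx, hpar₁]; decide
  · ----------------------------------------------------------------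
    rcases (show v = 1 ∨ 2 ≤ v by omega) with hone | htwo
    · -- Case `v = 1`: `v₂(x - 3) = 0`, `pres8 (x - 3) = 5 + 2 pres8 x`; `v₂(x + 2)` odd `≥ 3`
      have r₃ : pres8 (x - 3) = 5 + 2 ^ 1 * pres8 x := by
        rw [e₃', pres8_add_of_eq hm3 (k := 1) le_rfl
          (by rw [valuation_neg_three, ← hvdef, hone]; norm_num), pres8_neg_three]
      have hv₃ : (x - 3).valuation = 0 := by
        have d₃ := valuation_add_eq_left_of_lt 2 hm3 hx
          (by rw [valuation_neg_three, ← hvdef, hone]; norm_num)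
        rw [← e₃'] at d₃
        rw [d₃.2, valuation_neg_three]
      -- `x + 2 = 2 (x/2 + 1)` has valuation `≥ 2`
      have hxh0 : x / 2 ≠ 0 := div_ne_zero hx h2
      have hxh : (x / 2).valuation = 0 := by
        have e : x = 2 * (x / 2) := by field_simp
        have := Padic.valuation_mul h2 hxh0
        rw [← e, valuation_two, ← hvdef, hone] at this
        omega
      have hw2 : 2 ≤ (x + 2).valuation := by
        have hsum' : x / 2 + 1 ≠ 0 := by
          intro h0; apply hx₂; linear_combination (2 : ℚ_[2]) * h0
        have h1 := one_le_valuation_add_of_units hxh0 one_ne_zero hxh Padic.valuation_one hsum'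
        have e : x + 2 = 2 * (x / 2 + 1) := by field_simp
        rw [e, Padic.valuation_mul h2 hsum', valuation_two]
        omega
      have hwodd : ¬ Even ((x + 2).valuation) := by
        intro hev
        rw [hone, hv₃, add_zero] at hsum
        obtain ⟨k, hk⟩ := hev; obtain ⟨m, hm⟩ := hsum; omega
      have hw3 : 3 ≤ (x + 2).valuation := by
        rcases (show (x + 2).valuation = 2 ∨ 3 ≤ (x + 2).valuation by omega) with h2' | h3'
        · exact absurd ⟨1, by rw [h2']; rfl⟩ hwodd
        · exact h3'
      -- `2 = -x + (x + 2)`: `1 = 7 pres8 x + 2^{w-1} pres8 (x + 2)`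
      have r2d : (1 : ZMod (2 ^ 3)) =
          7 * pres8 x +
            (2 : ZMod (2 ^ 3)) ^ ((x + 2).valuation - 1).toNat * pres8 (x + 2) := by
        have := pres8_add_of_eq (t := -x) (s := x + 2) (neg_ne_zero.mpr hx)
          (k := ((x + 2).valuation - 1).toNat) (by omega)
          (by rw [valuation_neg_two, ← hvdef, hone]; omega)
        rw [show -x + (x + 2) = 2 by ring, pres8_two, pres8_neg hx] at this
        exact this
      have hpar₁ : (padicPlace 2).parity x = 1 :=
        par1 x (by rw [← hvdef, hone]; exact Int.not_even_one)
      have hpar₂ : (padicPlace 2).parity (x + 2) = 1 := par1 _ hwodd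
      rw [r₃] at hsq
      rcases (show (x + 2).valuation = 3 ∨ 4 ≤ (x + 2).valuation by omega) with hw | hw
      · rw [hw, show ((3 : ℤ) - 1).toNat = 2 from rfl] at r2d
        have key : ∀ r r₂ : ZMod (2 ^ 3), r * r = 1 → r₂ * r₂ = 1 →
            (1 : ZMod (2 ^ 3)) = 7 * r + 2 ^ 2 * r₂ → r * r₂ * (5 + 2 ^ 1 * r) = 1 →
            chi4Of r₂ = 0 ∧ chi8Of r₂ = chi8Of r + 1 := by decide
        obtain ⟨k1, k2⟩ := key _ _ hrx hrx₂ r2d hsq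
        exact ⟨by rw [hpar₁, hpar₂], k1, by rw [pc8, pc8, hpar₁]; exact k2⟩
      · rw [two_pow_eq_zero_of_le (by omega), zero_mul, add_zero] at r2d
        have key : ∀ r r₂ : ZMod (2 ^ 3), r * r = 1 → r₂ * r₂ = 1 → (1 : ZMod (2 ^ 3)) = 7 * r →
            r * r₂ * (5 + 2 ^ 1 * r) = 1 → chi4Of r₂ = 0 ∧ chi8Of r₂ = chi8Of r + 1 := by decide
        obtain ⟨k1, k2⟩ := key _ _ hrx hrx₂ r2d hsq
        exact ⟨by rw [hpar₁, hpar₂], k1, by rw [pc8, pc8, hpar₁]; exact k2⟩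
    · -- Case `v ≥ 2`: `v₂(x + 2) = 1`, `v₂(x - 3) = 0`, `v` odd `≥ 3`
      have d₂ := valuation_add_eq_left_of_lt 2 h2 hx (by rw [valuation_two, ← hvdef]; omega)
      rw [← e₂'] at d₂
      have d₃ := valuation_add_eq_left_of_lt 2 hm3 hx (by rw [valuation_neg_three, ← hvdef]; omega)
      rw [← e₃'] at d₃
      have hvodd : ¬ Even v := by
        intro hev
        rw [d₂.2, d₃.2, valuation_two, valuation_neg_three] at hsum
        obtain ⟨k, hk⟩ := hev; obtain ⟨m, hm⟩ := hsum; omega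
      have hv3 : 3 ≤ v := by
        rcases (show v = 2 ∨ 3 ≤ v by omega) with h2' | h3'
        · exact absurd ⟨1, by rw [h2']; rfl⟩ hvodd
        · exact h3'
      have r₃ : pres8 (x - 3) = 5 := by
        rw [e₃', pres8_add_of_eq hm3 (k := v.toNat) (by omega)
          (by rw [valuation_neg_three, ← hvdef]; omega),
          two_pow_eq_zero_of_le (by omega), zero_mul, add_zero, pres8_neg_three]
      have r₂ : pres8 (x + 2) = 1 + (2 : ZMod (2 ^ 3)) ^ (v - 1).toNat * pres8 x := by
        rw [e₂', pres8_add_of_eq h2 (k := (v - 1).toNat) (by omega)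
          (by rw [valuation_two, ← hvdef]; omega), pres8_two]
      have hpar₁ : (padicPlace 2).parity x = 1 := par1 x (by rw [← hvdef]; exact hvodd)
      have hpar₂ : (padicPlace 2).parity (x + 2) = 1 :=
        par1 _ (by rw [d₂.2, valuation_two]; exact Int.not_even_one)
      rw [r₃] at hsq
      rcases (show v = 3 ∨ 4 ≤ v by omega) with hw | hw
      · rw [hw, show ((3 : ℤ) - 1).toNat = 2 from rfl] at r₂
        have key : ∀ r r₂ : ZMod (2 ^ 3), r * r = 1 → r₂ = 1 + 2 ^ 2 * r → r * r₂ * 5 = 1 →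
            chi4Of r₂ = 0 ∧ chi8Of r₂ = chi8Of r + 1 := by decide
        obtain ⟨k1, k2⟩ := key _ _ hrx r₂ hsq
        exact ⟨by rw [hpar₁, hpar₂], by rw [pc4]; exact k1, by rw [pc8, pc8, hpar₁]; exact k2⟩
      · rw [two_pow_eq_zero_of_le (by omega), zero_mul, add_zero] at r₂
        have key : ∀ r r₂ : ZMod (2 ^ 3), r * r = 1 → r₂ = 1 → r * r₂ * 5 = 1 →
            chi4Of r₂ = 0 ∧ chi8Of r₂ = chi8Of r + 1 := by decide
        obtain ⟨k1, k2⟩ := key _ _ hrx r₂ hsq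
        exact ⟨by rw [hpar₁, hpar₂], by rw [pc4]; exact k1, by rw [pc8, pc8, hpar₁]; exact k2⟩

end DokchitserDokchitser2011

end Literature.Barriers.BirchSwinnertonDyer

end
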